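import Mathlib
import Summits.Ventures.FusionMHD.Models.RwmFRS1Kq07Energy
import Summits.Ventures.FusionMHD.Models.RwmFRS1Kq07BesselSharp
import HarnessLib

/-!
# F3.r4 instance «RwmFRS1Kq07» — RIDER: sharpened thin-wall RWM rates (`±1.4 %`) and the critical wall radius to `±1.6 %`
# for the external `(2,1)` mode of MODEL M_RWM,K, from the second-order cutoff bound for `K_2`

Rider of `RwmFRS1Kq07Energy.lean` (model-6 g7).  Same MODEL M_RWM,K (`KinkEqQ07.hlK` + vacuum + thin resistive wall, `R₀ = 5a`),
same CLASS C = external `(2,1)`, same marginal solution `Kq07.xi` and `Λ_crit ∈ (1.38197, 1.38198)`; only the `m = 2` wall-factor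
brackets are replaced by the sharpened ones of `RwmFRS1Kq07BesselSharp.lean` (`besselKReal_two_le_cutoff`,
`Literature/Analysis/FunctionSpaces/BesselKTwoCutoffBound.lean`): `Λ_b(13/50) ∈ [2.0455, 2.062]`, `Λ_b(6/25) ∈ [2.8178, 2.8448]`,
`Λ_b(31/100) ≥ 1.3975`, `Λ_b(8/25) ≤ 1.3484`, `Λ_∞ ∈ [0.99, 0.99074]`.
CERTIFIED: **`rwm_rate_13_sharp`: `0.575 < γτ_w < 0.591` at `b = 13/10·a`** (was `(0.54, 0.62)`); **`rwm_rate_12_sharp`: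
`0.267 < γτ_w < 0.2731` at `b = 6/5·a`** (was `(0.256, 0.283)`); **`criticalWallRadius_bounds_sharp`: `31/20·a < b* < 8/5·a`**
(was `(3/2, 7/4)`; VALIDATED float `1.5659a`), with `dWb_pos_31` / `dWb_neg_32` and `idealWall_window_sharp` (every ideal wall
`a < b ≤ 31/20·a` stabilises every admissible displacement).  VALIDATED floats `0.5835`, `0.2703`.  Never «stable» without MODEL
M_RWM,K + CLASS (2,1); the same model's `(1,1)` internal kink is certified unstable (★ #95); nothing about a device. [instance data]
-/

noncomputable section

open Set Filter Literature.MathematicalPhysics.MHD Literature.MathematicalPhysics.MHD.ScrewPinch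
open scoped Topology

namespace Summit.Ventures.FusionMHD.Models

namespace RwmFRS1

namespace Kq07

/-- **Ideal wall at `b = 31/20·a`: `δW_b > 0`** (`Λ_b(31/100) ≥ 1.3975 > Λ_crit`). [cite: Freidberg2014, §11.5.6 eq. (11.149)] -/
theorem dWb_pos_31 : 0 < Kq07.dWb (31 / 20) := by
  rw [Kq07.dWb, externalEnergy_xi]
  have hΛ : (559 / 400 : ℝ) ≤ Vacuum.wallFactor 2 kk 1 (31 / 20) := by
    rw [wallFactor_two_eq, show (1 / 5 : ℝ) * (31 / 20) = 31 / 100 by norm_num]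
    exact lambdaWall_31_bounds_sharp.1
  have hpos : 0 < Kq07.boundaryForm (1 * deriv Kq07.xi 1 / Kq07.xi 1) (Vacuum.wallFactor 2 kk 1 (31 / 20)) := by
    rw [boundaryForm_pos_iff]
    linarith [lambdaCrit_bounds.2]
  exact mul_pos hpos xi_one_sq_pos

/-- **Ideal wall at `b = 8/5·a`: `δW_b < 0`** (`Λ_b(8/25) ≤ 1.3484 < Λ_crit`). [cite: Freidberg2014, §11.5.6 eq. (11.149)] -/
theorem dWb_neg_32 : Kq07.dWb (8 / 5) < 0 := by
  rw [Kq07.dWb, externalEnergy_xi]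
  have hΛ : Vacuum.wallFactor 2 kk 1 (8 / 5) ≤ (3371 / 2500 : ℝ) := by
    rw [wallFactor_two_eq, show (1 / 5 : ℝ) * (8 / 5) = 8 / 25 by norm_num]
    exact lambdaWall_32_bounds_sharp.2
  have hneg : Kq07.boundaryForm (1 * deriv Kq07.xi 1 / Kq07.xi 1) (Vacuum.wallFactor 2 kk 1 (8 / 5)) < 0 := by
    rw [boundaryForm_neg_iff]
    linarith [lambdaCrit_bounds.1]
  exact mul_neg_of_neg_of_pos hneg xi_one_sq_pos

/-- **`31/20·a < b* < 8/5·a`** — the critical wall radius of the `(2,1)` mode of MODEL M_RWM,K to `±1.6 %` (VALIDATED float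
`1.5659a`). [cite: Freidberg2014, §11.5.6 p. 491] -/
theorem criticalWallRadius_bounds_sharp : (31 / 20 : ℝ) < PK.criticalWallRadius 2 kk 1 Kq07.xi ∧
    PK.criticalWallRadius 2 kk 1 Kq07.xi < (8 / 5 : ℝ) :=
  ⟨(dWb_pos_iff (by norm_num)).1 dWb_pos_31, (dWb_neg_iff (by norm_num)).1 dWb_neg_32⟩

/-- **The ideal-wall window extended: every wall `a < b ≤ 31/20·a` stabilises every admissible displacement** (MODEL M_RWM,K,
mode `(2,1)`). [cite: Freidberg2014, §11.5.6 eq. (11.151)] -/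
theorem idealWall_window_sharp {b : ℝ} (hb1 : 1 < b) (hb2 : b ≤ 31 / 20) :
    ∀ ξ : ℝ → ℝ, IsAdmissible ξ → 0 < PK.externalEnergy 2 kk 1 (Vacuum.wallFactor 2 kk 1 b) ξ :=
  (idealWall_stable_iff hb1).2 (lt_of_le_of_lt hb2 criticalWallRadius_bounds_sharp.1)

/-- **SHARP RATE AT `b = 13/10·a`: `0.575 < γτ_w < 0.591`** (`Λ_b(13/50) ∈ [2.0455, 2.062]`, `Λ_∞ ∈ [0.99, 0.99074]`,
`Λ_crit ∈ (1.38197, 1.38198)`; exact range `(0.57533, 0.59075)`; VALIDATED float `0.5835`). [cite: Freidberg2014, §11.5.6 eq. (11.169)] -/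
theorem rwm_rate_13_sharp {γ τw : ℝ} (h : ResistiveWall.IsThinWallRate Kq07.dWinf (Kq07.dWb (13 / 10)) τw γ) :
    (23 / 40 : ℝ) < γ * τw ∧ γ * τw < (591 / 1000 : ℝ) := by
  have key := rate_key h
  rw [show (1 / 5 : ℝ) * (13 / 10) = 13 / 50 by norm_num] at key
  obtain ⟨hc1, hc2⟩ := lambdaCrit_bounds
  obtain ⟨hi1, hi2⟩ := lambdaInf_two_bounds_sharp
  obtain ⟨hb1, hb2⟩ := lambdaWall_26_bounds_sharp
  set Lc := Kq07.lambdaCrit (1 * deriv Kq07.xi 1 / Kq07.xi 1)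
  set Li := Vacuum.lambdaInf 2 (1 / 5)
  set Lb := Vacuum.lambdaWall 2 (1 / 5) (13 / 50)
  have hd : 0 < Lb - Lc := by linarith
  constructor
  · by_contra hle
    rw [not_lt] at hle
    have : γ * τw * (Lb - Lc) ≤ 23 / 40 * (Lb - Lc) := mul_le_mul_of_nonneg_right hle hd.le
    nlinarith
  · by_contra hle
    rw [not_lt] at hle
    have : 591 / 1000 * (Lb - Lc) ≤ γ * τw * (Lb - Lc) := mul_le_mul_of_nonneg_right hle hd.le
    nlinarith

/-- **SHARP RATE AT `b = 6/5·a`: `0.267 < γτ_w < 0.2731`** (`Λ_b(6/25) ∈ [2.8178, 2.8448]`; exact range `(0.26745, 0.27300)`;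
VALIDATED float `0.2703`). [cite: Freidberg2014, §11.5.6 eq. (11.169)] -/
theorem rwm_rate_12_sharp {γ τw : ℝ} (h : ResistiveWall.IsThinWallRate Kq07.dWinf (Kq07.dWb (6 / 5)) τw γ) :
    (267 / 1000 : ℝ) < γ * τw ∧ γ * τw < (2731 / 10000 : ℝ) := by
  have key := rate_key h
  rw [show (1 / 5 : ℝ) * (6 / 5) = 6 / 25 by norm_num] at key
  obtain ⟨hc1, hc2⟩ := lambdaCrit_bounds
  obtain ⟨hi1, hi2⟩ := lambdaInf_two_bounds_sharp
  obtain ⟨hb1, hb2⟩ := lambdaWall_24_bounds_sharp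
  set Lc := Kq07.lambdaCrit (1 * deriv Kq07.xi 1 / Kq07.xi 1)
  set Li := Vacuum.lambdaInf 2 (1 / 5)
  set Lb := Vacuum.lambdaWall 2 (1 / 5) (6 / 25)
  have hd : 0 < Lb - Lc := by linarith
  constructor
  · by_contra hle
    rw [not_lt] at hle
    have : γ * τw * (Lb - Lc) ≤ 267 / 1000 * (Lb - Lc) := mul_le_mul_of_nonneg_right hle hd.le
    nlinarith
  · by_contra hle
    rw [not_lt] at hle
    have : 2731 / 10000 * (Lb - Lc) ≤ γ * τw * (Lb - Lc) := mul_le_mul_of_nonneg_right hle hd.le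
    nlinarith

end Kq07

end RwmFRS1

end Summit.Ventures.FusionMHD.Models

end
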